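import Literature.MathematicalPhysics.QuantumFieldTheory.Balaban1983to89.Node00.Carriers

/-!
# NODE 00 (YM-PLAN Track A) — STAGE-1 FRAME: what the carrier bundle of record `carriers₁ θ X` PINS and what it leaves FREE,
# leaf by leaf, and the thirteen DAG node statements at a world of record (Stage 1) UNFOLDED to the printed leaves they assert

NODE 00 STAGE-1 COMPANION MODULE (seat `pub-ymgap-node00-def`; the CONVENTIONS OF RECORD block of the root module `Node00Carriers`
applies here).  APPEND-ONLY GROWTH (P8″ (ii)): a NEW importing module, no edit of `Node00Carriers`.  PURPOSE — the VACUITY STANDARD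
(Q-N00-6) and the cross-read (ym3ir-theory-1's XREAD-PREP §2 (i): «the concrete field unfolds — by `rfl`, `simp`, or a lemma S6 states
next to the definition»), made kernel-checkable: every statement below is `rfl`-bookkeeping or a one-line consequence of the two Stage-1
leaves `carriers₁_b4 ∕ carriers₁_b5`; NOTHING of Bałaban's is asserted; no node is discharged here.  One finite T⁴ programme at fixed ε;
NOT ℝ⁴ ∕ infinite volume ∕ OS ∕ mass gap ∕ Clay.

WHAT THIS FILE RECORDS (0 sorry; axioms {propext, Classical.choice, Quot.sound}):
* §1 FIELD LEVEL — the PINNED groups of `carriers₁ θ X` ARE the lineage families at `θ`'s parameters (`carriers₁_groupB4`: `famE famU famF d4 N4` =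
  `torusPairFam ∕ regularFieldRegionsW ∕ regularFormSetting ∕ d₅ ∕ N₅`; `carriers₁_groupB5`: `I5 fam5 forms5` = `TopIdx D L ∕ famG D L a ∕
  formsOfRecord D L`), and the FREE groups are `X`'s own, byte for byte (`carriers₁_groupB6 ∕ _groupB7 ∕ _groupB8 ∕ _groupB10 ∕ _groupB12 ∕ _groupB13`);
* §2 LEAF LEVEL — at the N-binding `Upstream.ofPrintedAllXPN (carriers₁ θ X) Y Z V W` the leaves `b4`, `b5` are the printed statements AT THE
  OBJECTS OF RECORD (`leaves_carriers₁_pinned`: `B4LeafNN (torusPairFam …) (regularFieldRegionsW …) (regularFormSetting …) d₅ N₅`,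
  `B5.MainBlock (famG D L a) (formsOfRecord D L)`), and EVERY OTHER LEAF is literally the leaf of the un-substituted bundles
  (`leaves_carriers₁_free`: `b6 … b13`, `rOperation`, `rBasicStep` of `ofPrintedAllXPN X Y Z V W` — `B6BlockParam X.D6`, `B7.Concl X.L7 …`, `B9LeafX Y`,
  `B11Leaf Z`, `ROpLeaf V`, `B15Leaf W`, … by `DagDischargedII.ofPrintedAllXPN_leaves`);
* §3 NODE LEVEL — at a run `P` of a world with `w.up P = ofPrintedAllXPN (carriers₁ θ X) Y Z V W` (admissible `θ`): N01 and N02 hold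
  (`Node00Carriers`), and the eight other carrier-only nodes REDUCE to the printed leaves of the run's FREE carriers with the pinned antecedents
  `b4`, `b5` discharged — e.g. `b6_main_iff_of_up : Dag.B6_main (leavesP w P) ↔ B6BlockParam X.D6`, `b7_main_iff_of_up : Dag.B7_main (leavesP w P) ↔
  B7.Concl X.L7 X.c₂ X.C₀ X.c₂' X.one7 X.kst7 X.kexp7 X.gd7 X.gone7`, and N05 ∕ N06 ∕ N07 ∕ N08 ∕ N10 ∕ N12 likewise (`b8_ ∕ b9_ ∕ b11_ ∕ b10_ ∕ b13_ ∕
  b15_main_iff_of_up`).  READ THIS AS the in-edge VACUITY MAP of YM-PLAN §1 ∕ FIRST3-READINESS §0 (f) in kernel form: at Stage 1 a node beyond N02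
  asserts its paper's leaf at carriers NOT YET of record, so it is neither dischargeable nor refutable «at the objects of record» until its stage
  pins them (Stage 2 = B7 in `Node00Carriers2`; the one-level B6 block is the side predicate of `Node00Carriers` §5);
* §4 the same three facts for the ONE-LEVEL side bundle `carriers₁OL θ ν X` (`leaves_carriers₁OL_pinned ∕ _free`, `b7_main_iff_of_up_OL`,
  `b9_main_iff_of_up_OL`).
-/

noncomputable section

namespace Literature.MathematicalPhysics.QuantumFieldTheory.Balaban1983to89.Node00

open scoped Matrix
open DagBinding DagDischargedII B4GaugeCovariance
open B4ThmRegionPairEta (Kmod)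
open B4TorusPairFam (torusPairFam)
open B4Prop23RegularWindow (regularFieldRegionsW)
open B4Prop31Regular (regularFormSetting)
open B5ResidualGpTorusHolds (TopIdx)
open B5Prop12GLattice (famG)
open B6LeafB6OneLevelFamG (knitBlockG)
open B6Prop22BlockFamily (blockGp)

variable (θ : Stage1Params) (X : PrintedCarriersR) (Y : PrintedCarriers9X) (Z : PrintedCarriers11) (V : PrintedCarriers14R)
  (W : PrintedCarriers15)

/-! ## §1. Field level: the pinned groups are the lineage families, the free groups are `X`'s -/

/-- **The B4 group of `carriers₁ θ X` IS the [Balaban1983RegularityDecay] family of the r01 lineage at `θ`** (`rfl`): `famE` = the torus region-pair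
family `torusPairFam` at the flow `θ.F`, lattice `ℤ^{(D−1)+1}`, block `ℓ = L − 1`, windows `[a₋, a₊]`, `m²₊`, (1.7)-constants `(c, β)`, big blocks
`Kmod …`; `famU` = `regularFieldRegionsW`; `famF` = `regularFormSetting`; `(d4, N4) = (d₅, N₅)`. [cite: Balaban1983RegularityDecay, (1.1)–(1.7) pp.572–573, Props. 2.3 / 3.1′ p.574 (dictionary, bookkeeping)] -/
theorem carriers₁_groupB4 :
    (carriers₁ θ X).famE = torusPairFam θ.F (θ.D - 1) (θ.L - 1) θ.amin θ.aplus θ.m2plus θ.creg θ.β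
        (Kmod θ.F θ.hℓ₁ θ.hLip (θ.D - 1) (θ.L - 1) θ.one_le_pred θ.amin θ.aplus θ.m2plus θ.ha) ∧
    (carriers₁ θ X).famU = regularFieldRegionsW (d := θ.D - 1) θ.F
        (Nat.succ_le_succ (Nat.zero_le (θ.L - 1)) : 1 ≤ θ.L - 1 + 1) θ.amin θ.aplus θ.a' θ.creg θ.β θ.m2plus ∧
    (carriers₁ θ X).famF = regularFormSetting (d := θ.D - 1) θ.F θ.a θ.m2 θ.C θ.a₀ θ.p ∧
    (carriers₁ θ X).d4 = θ.d₅ ∧ (carriers₁ θ X).N4 = θ.N₅ :=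
  ⟨rfl, rfl, rfl, rfl, rfl⟩

/-- **The B5 group of `carriers₁ θ X` IS the [Balaban1984PropagatorsI] family of the lineages at `θ`** (`rfl`): index = the top-level tori `TopIdx D L`,
settings = `famG D L a` (`G = Δ_a⁻¹`), forms = `formsOfRecord D L`. [cite: Balaban1984PropagatorsI, Props. 1.1–1.2 pp.33–36, (1.64)–(1.67) p.29 (dictionary, bookkeeping)] -/
theorem carriers₁_groupB5 :
    (carriers₁ θ X).I5 = TopIdx θ.D θ.L ∧ (carriers₁ θ X).fam5 = famG θ.D θ.L θ.a ∧
      (carriers₁ θ X).forms5 = formsOfRecord θ.D θ.L :=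
  ⟨rfl, rfl, rfl⟩

/-- The B6 block data of `carriers₁ θ X` is `X`'s (FREE at Stage 1). [cite: Balaban1984PropagatorsII, (2.1)–(2.2) p.224 (dictionary, bookkeeping)] -/
theorem carriers₁_groupB6 : (carriers₁ θ X).D6 = X.D6 := rfl

/-- The B7 group ([Balaban1985Averaging] constants and five families) of `carriers₁ θ X` is `X`'s (FREE at Stage 1; pinned at Stage 2). [cite: Balaban1985Averaging, pp.18–19, Props. 1–10 pp.26–50 (dictionary, bookkeeping)] -/
theorem carriers₁_groupB7 :
    (carriers₁ θ X).L7 = X.L7 ∧ (carriers₁ θ X).c₂ = X.c₂ ∧ (carriers₁ θ X).C₀ = X.C₀ ∧ (carriers₁ θ X).c₂' = X.c₂' ∧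
    (carriers₁ θ X).one7 = X.one7 ∧ (carriers₁ θ X).kst7 = X.kst7 ∧ (carriers₁ θ X).kexp7 = X.kexp7 ∧
    (carriers₁ θ X).gd7 = X.gd7 ∧ (carriers₁ θ X).gone7 = X.gone7 :=
  ⟨rfl, rfl, rfl, rfl, rfl, rfl, rfl, rfl, rfl⟩

/-- The B8 group ([Balaban1985RegularSpaces] constants, four families, the axial-gauge map and the R-extension predicates) of `carriers₁ θ X` is
`X`'s (FREE at Stage 1). [cite: Balaban1985RegularSpaces, (1.140) p.100, Thm 8 p.101 (dictionary, bookkeeping)] -/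
theorem carriers₁_groupB8 :
    (carriers₁ θ X).d8 = X.d8 ∧ (carriers₁ θ X).L8 = X.L8 ∧ (carriers₁ θ X).C₂ = X.C₂ ∧ (carriers₁ θ X).B₁' = X.B₁' ∧
    (carriers₁ θ X).B₀' = X.B₀' ∧ (carriers₁ θ X).B₁ = X.B₁ ∧ (carriers₁ θ X).B₂ = X.B₂ ∧ (carriers₁ θ X).c₁ = X.c₁ ∧
    (carriers₁ θ X).inp8 = X.inp8 ∧ (carriers₁ θ X).B₀β = X.B₀β ∧ (carriers₁ θ X).loc8 = X.loc8 ∧ (carriers₁ θ X).fam8 = X.fam8 ∧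
    (carriers₁ θ X).lan8 = X.lan8 ∧ (carriers₁ θ X).cub8 = X.cub8 ∧ (carriers₁ θ X).toAxial8 = X.toAxial8 ∧
    (carriers₁ θ X).C140 = X.C140 ∧ (carriers₁ θ X).InR = X.InR :=
  ⟨rfl, rfl, rfl, rfl, rfl, rfl, rfl, rfl, rfl, rfl, rfl, rfl, rfl, rfl, rfl, rfl, rfl⟩

/-- The B10 run family ([Balaban1985UV3]) of `carriers₁ θ X` is `X`'s (FREE at Stage 1). [cite: Balaban1985UV3, Thm 1 p.257, Thm 2 p.272 (dictionary, bookkeeping)] -/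
theorem carriers₁_groupB10 : (carriers₁ θ X).I10 = X.I10 ∧ (carriers₁ θ X).runs10 = X.runs10 := ⟨rfl, rfl⟩

/-- The B12 §§2–5 frame and constants ([Balaban1987RG1] Lemma 4) of `carriers₁ θ X` are `X`'s (FREE at Stage 1). [cite: Balaban1987RG1, Lemma 4 p.280 (dictionary, bookkeeping)] -/
theorem carriers₁_groupB12 : (carriers₁ θ X).F12 = X.F12 ∧ (carriers₁ θ X).c12 = X.c12 := ⟨rfl, rfl⟩

/-- The B13 step data and constants ([Balaban1988RG2Cluster]) of `carriers₁ θ X` are `X`'s (FREE at Stage 1). [cite: Balaban1988RG2Cluster, Lemmas 1–3 pp.1–20 (dictionary, bookkeeping)] -/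
theorem carriers₁_groupB13 : (carriers₁ θ X).S13 = X.S13 ∧ (carriers₁ θ X).c13 = X.c13 := ⟨rfl, rfl⟩

/-! ## §2. Leaf level: the N-binding's leaves over `carriers₁ θ X` -/

/-- **The two PINNED leaves are the printed statements at the objects of record** (`rfl`): `b4` = `B4LeafNN` (Theorem p. 573 in its `0 ≤ α` form ∧
Prop. 2.3 ∧ Prop. 3.1′ ∧ Sect. 5 Theorem) of the [Balaban1983RegularityDecay] families of record; `b5` = `B5.MainBlock` (Prop. 1.1 ∧ Prop. 1.2 ∧ (1.67))
of the [Balaban1984PropagatorsI] families of record. [cite: Balaban1983RegularityDecay, Theorem p.573, Props. 2.3 / 3.1′ p.574, Sect. 5 Theorem p.594; Balaban1984PropagatorsI, Props. 1.1–1.2 pp.33–36, (1.67) p.29 (dictionary, bookkeeping)] -/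
theorem leaves_carriers₁_pinned :
    (Upstream.ofPrintedAllXPN (carriers₁ θ X) Y Z V W).b4 =
      B4LeafNN
        (torusPairFam θ.F (θ.D - 1) (θ.L - 1) θ.amin θ.aplus θ.m2plus θ.creg θ.β
          (Kmod θ.F θ.hℓ₁ θ.hLip (θ.D - 1) (θ.L - 1) θ.one_le_pred θ.amin θ.aplus θ.m2plus θ.ha))
        (regularFieldRegionsW (d := θ.D - 1) θ.F (Nat.succ_le_succ (Nat.zero_le (θ.L - 1)) : 1 ≤ θ.L - 1 + 1)
          θ.amin θ.aplus θ.a' θ.creg θ.β θ.m2plus)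
        (regularFormSetting (d := θ.D - 1) θ.F θ.a θ.m2 θ.C θ.a₀ θ.p) θ.d₅ θ.N₅ ∧
    (Upstream.ofPrintedAllXPN (carriers₁ θ X) Y Z V W).b5 = B5.MainBlock (famG θ.D θ.L θ.a) (formsOfRecord θ.D θ.L) :=
  ⟨rfl, rfl⟩

/-- **Every OTHER leaf over `carriers₁ θ X` is literally the leaf over the un-substituted bundles** (`rfl`): `b6 … b13`, `rOperation`, `rBasicStep` —
i.e. `B6BlockParam X.D6`, `B7.Concl X.L7 …`, the faithful B8 leaf of `X`, `B9LeafX Y`, `B10.Thm1Printed X.runs10 ∧ …`, `B11Leaf Z`,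
`B12Sec2to5.Lemma4Printed X.F12 X.c12`, the B13 triple of `X`, `ROpLeaf V`, `B15Leaf W` (`DagDischargedII.ofPrintedAllXPN_leaves`). [cite: Balaban1984PropagatorsII, Lemma 2.1 p.234; Balaban1985Averaging, Props. 1–10 pp.26–50 (dictionary, bookkeeping: the un-pinned leaves)] -/
theorem leaves_carriers₁_free :
    (Upstream.ofPrintedAllXPN (carriers₁ θ X) Y Z V W).b6 = (Upstream.ofPrintedAllXPN X Y Z V W).b6 ∧
    (Upstream.ofPrintedAllXPN (carriers₁ θ X) Y Z V W).b7 = (Upstream.ofPrintedAllXPN X Y Z V W).b7 ∧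
    (Upstream.ofPrintedAllXPN (carriers₁ θ X) Y Z V W).b8 = (Upstream.ofPrintedAllXPN X Y Z V W).b8 ∧
    (Upstream.ofPrintedAllXPN (carriers₁ θ X) Y Z V W).b9 = (Upstream.ofPrintedAllXPN X Y Z V W).b9 ∧
    (Upstream.ofPrintedAllXPN (carriers₁ θ X) Y Z V W).b10 = (Upstream.ofPrintedAllXPN X Y Z V W).b10 ∧
    (Upstream.ofPrintedAllXPN (carriers₁ θ X) Y Z V W).b11 = (Upstream.ofPrintedAllXPN X Y Z V W).b11 ∧
    (Upstream.ofPrintedAllXPN (carriers₁ θ X) Y Z V W).b12 = (Upstream.ofPrintedAllXPN X Y Z V W).b12 ∧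
    (Upstream.ofPrintedAllXPN (carriers₁ θ X) Y Z V W).b13 = (Upstream.ofPrintedAllXPN X Y Z V W).b13 ∧
    (Upstream.ofPrintedAllXPN (carriers₁ θ X) Y Z V W).rOperation = (Upstream.ofPrintedAllXPN X Y Z V W).rOperation ∧
    (Upstream.ofPrintedAllXPN (carriers₁ θ X) Y Z V W).rBasicStep = (Upstream.ofPrintedAllXPN X Y Z V W).rBasicStep :=
  ⟨rfl, rfl, rfl, rfl, rfl, rfl, rfl, rfl, rfl, rfl⟩

/-- The two free leaves the first-three nodes read, unfolded to their printed predicates (`rfl`): `b6` = the parameter-form block of `X`'s block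
data, `b7` = `B7.Concl` of `X`'s B7 group. [cite: Balaban1984PropagatorsII, Lemma 2.1 p.234; Balaban1985Averaging, Props. 1–10 pp.26–50 (dictionary, bookkeeping)] -/
theorem leaves_carriers₁_b6_b7 :
    (Upstream.ofPrintedAllXPN (carriers₁ θ X) Y Z V W).b6 = B6BlockParam X.D6 ∧
    (Upstream.ofPrintedAllXPN (carriers₁ θ X) Y Z V W).b7 =
      B7.Concl X.L7 X.c₂ X.C₀ X.c₂' X.one7 X.kst7 X.kexp7 X.gd7 X.gone7 :=
  ⟨rfl, rfl⟩

/-! ## §3. Node level: the carrier-only DAG nodes at a run of a world of record, Stage 1 -/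

section Nodes

variable {θ X Y Z V W} (hθ : θ.Admissible) {w : WorldP} {P : B12.RunParams}
  (hP : w.up P = Upstream.ofPrintedAllXPN (carriers₁ θ X) Y Z V W)

include hP in
/-- **N01 at the run, unfolded**: `Dag.B4_main (leavesP w P)` IS the NN leaf of the [Balaban1983RegularityDecay] families of record (and holds,
`b4_main_of_isWorldOfRecord₁`). [cite: Balaban1983RegularityDecay, Theorem p.573, Props. 2.3 / 3.1′ p.574, Sect. 5 Theorem p.594 (dictionary, bookkeeping)] -/
theorem b4_main_iff_of_up :
    Dag.B4_main (leavesP w P) ↔ (Upstream.ofPrintedAllXPN (carriers₁ θ X) Y Z V W).b4 := by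
  show (w.up P).b4 ↔ _
  rw [hP]

include hP in
/-- **N02 at the run, unfolded**: `Dag.B5_main (leavesP w P)` («b4 → b5») IS `b4 → B5.MainBlock (famG D L a) (formsOfRecord D L)` at the objects of
record (and holds, `b5_main_of_isWorldOfRecord₁`). [cite: Balaban1984PropagatorsI, Props. 1.1–1.2 pp.33–36, (1.67) p.29 (dictionary, bookkeeping)] -/
theorem b5_main_iff_of_up :
    Dag.B5_main (leavesP w P) ↔
      ((Upstream.ofPrintedAllXPN (carriers₁ θ X) Y Z V W).b4 → B5.MainBlock (famG θ.D θ.L θ.a) (formsOfRecord θ.D θ.L)) := by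
  show ((w.up P).b4 → (w.up P).b5) ↔ _
  rw [hP]
  exact Iff.rfl

include hθ hP in
/-- **N03 at a Stage-1 run REDUCES to the parameter-form block leaf of the run's FREE block data** (`b4`, `b5` discharged): `Dag.B6_main (leavesP w P) ↔
B6BlockParam X.D6` — dischargeable «at the objects of record» only once a stage pins `X.D6` (one-level special case: `Node00Carriers` §5;
multi-level: a later stage). [cite: Balaban1984PropagatorsII, Lemma 2.1 – Cor. 2.8 pp.234–249 (dictionary, bookkeeping)] -/
theorem b6_main_iff_of_up : Dag.B6_main (leavesP w P) ↔ B6BlockParam X.D6 := by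
  show ((w.up P).b4 → (w.up P).b5 → (w.up P).b6) ↔ _
  rw [hP]
  exact ⟨fun h => h (carriers₁_b4 θ hθ X Y Z V W) (carriers₁_b5 θ hθ X Y Z V W), fun h _ _ => h⟩

include hθ hP in
/-- **N04 at a Stage-1 run REDUCES to `B7.Concl` of the run's FREE B7 group** (`b5` discharged): `Dag.B7_main (leavesP w P) ↔ B7.Concl X.L7 X.c₂ X.C₀
X.c₂' X.one7 X.kst7 X.kexp7 X.gd7 X.gone7` — pinned at Stage 2 (`Node00Carriers2`). [cite: Balaban1985Averaging, Props. 1–10 pp.26–50 (dictionary, bookkeeping)] -/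
theorem b7_main_iff_of_up :
    Dag.B7_main (leavesP w P) ↔ B7.Concl X.L7 X.c₂ X.C₀ X.c₂' X.one7 X.kst7 X.kexp7 X.gd7 X.gone7 := by
  show ((w.up P).b5 → (w.up P).b7) ↔ _
  rw [hP]
  exact ⟨fun h => h (carriers₁_b5 θ hθ X Y Z V W), fun h _ => h⟩

include hθ hP in
/-- **N06 at a Stage-1 run**: `Dag.B9_main (leavesP w P)` («b4 → b5 → b6 → b7 → b9») ↔ `b6 → b7 → b9` over the run's FREE carriers `X.D6`, `X`'s B7
group, `Y`. [cite: Balaban1985BackgroundPropagators, Thms 3.1–3.15 pp.397–432 (dictionary, bookkeeping)] -/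
theorem b9_main_iff_of_up :
    Dag.B9_main (leavesP w P) ↔
      ((Upstream.ofPrintedAllXPN X Y Z V W).b6 → (Upstream.ofPrintedAllXPN X Y Z V W).b7 →
        (Upstream.ofPrintedAllXPN X Y Z V W).b9) := by
  show ((w.up P).b4 → (w.up P).b5 → (w.up P).b6 → (w.up P).b7 → (w.up P).b9) ↔ _
  rw [hP]
  exact ⟨fun h => h (carriers₁_b4 θ hθ X Y Z V W) (carriers₁_b5 θ hθ X Y Z V W), fun h _ _ => h⟩

include hθ hP in
/-- **N05 at a Stage-1 run**: `Dag.B8_main (leavesP w P)` («b5 → b6 → b7 → b9 → b8») ↔ `b6 → b7 → b9 → b8` over the run's FREE carriers.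
[cite: Balaban1985RegularSpaces, Thm 2 p.83, Thm 4 p.88, Thm 8 p.101 (dictionary, bookkeeping)] -/
theorem b8_main_iff_of_up :
    Dag.B8_main (leavesP w P) ↔
      ((Upstream.ofPrintedAllXPN X Y Z V W).b6 → (Upstream.ofPrintedAllXPN X Y Z V W).b7 →
        (Upstream.ofPrintedAllXPN X Y Z V W).b9 → (Upstream.ofPrintedAllXPN X Y Z V W).b8) := by
  show ((w.up P).b5 → (w.up P).b6 → (w.up P).b7 → (w.up P).b9 → (w.up P).b8) ↔ _
  rw [hP]
  exact ⟨fun h => h (carriers₁_b5 θ hθ X Y Z V W), fun h _ => h⟩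

include hθ hP in
/-- **N07 at a Stage-1 run**: `Dag.B11_main (leavesP w P)` («b5 → b6 → b7 → b8 → b9 → b11») ↔ `b6 → b7 → b8 → b9 → b11` over the run's FREE
carriers (`b11 = B11Leaf Z`). [cite: Balaban1985Variational, Thm 1 p.279, Props. 2–9 pp.281–309 (dictionary, bookkeeping)] -/
theorem b11_main_iff_of_up :
    Dag.B11_main (leavesP w P) ↔
      ((Upstream.ofPrintedAllXPN X Y Z V W).b6 → (Upstream.ofPrintedAllXPN X Y Z V W).b7 →
        (Upstream.ofPrintedAllXPN X Y Z V W).b8 → (Upstream.ofPrintedAllXPN X Y Z V W).b9 →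
          (Upstream.ofPrintedAllXPN X Y Z V W).b11) := by
  show ((w.up P).b5 → (w.up P).b6 → (w.up P).b7 → (w.up P).b8 → (w.up P).b9 → (w.up P).b11) ↔ _
  rw [hP]
  exact ⟨fun h => h (carriers₁_b5 θ hθ X Y Z V W), fun h _ => h⟩

include hθ hP in
/-- **N08 at a Stage-1 run**: `Dag.B10_main (leavesP w P)` («b5 → … → b11 → b10») ↔ `b6 → b7 → b8 → b9 → b11 → b10` over the run's FREE carriers
(`b10 = B10.Thm1Printed X.runs10 ∧ B10.Thm2Printed X.runs10` — the carver's Q2 on the b10 leaf of record is open). [cite: Balaban1985UV3, Thm 1 p.257, Thm 2 p.272 (dictionary, bookkeeping)] -/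
theorem b10_main_iff_of_up :
    Dag.B10_main (leavesP w P) ↔
      ((Upstream.ofPrintedAllXPN X Y Z V W).b6 → (Upstream.ofPrintedAllXPN X Y Z V W).b7 →
        (Upstream.ofPrintedAllXPN X Y Z V W).b8 → (Upstream.ofPrintedAllXPN X Y Z V W).b9 →
          (Upstream.ofPrintedAllXPN X Y Z V W).b11 → (Upstream.ofPrintedAllXPN X Y Z V W).b10) := by
  show ((w.up P).b5 → (w.up P).b6 → (w.up P).b7 → (w.up P).b8 → (w.up P).b9 → (w.up P).b11 → (w.up P).b10) ↔ _
  rw [hP]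
  exact ⟨fun h => h (carriers₁_b5 θ hθ X Y Z V W), fun h _ => h⟩

include hP in
/-- **N10 at a Stage-1 run**: `Dag.B13_main (leavesP w P)` («b9 → b10 → b11 → b12 → b13») reads FREE carriers only — it is literally the statement over
`X Y Z V W`. [cite: Balaban1988RG2Cluster, Lemmas 1–3 pp.1–20 (dictionary, bookkeeping)] -/
theorem b13_main_iff_of_up :
    Dag.B13_main (leavesP w P) ↔
      ((Upstream.ofPrintedAllXPN X Y Z V W).b9 → (Upstream.ofPrintedAllXPN X Y Z V W).b10 →
        (Upstream.ofPrintedAllXPN X Y Z V W).b11 → (Upstream.ofPrintedAllXPN X Y Z V W).b12 →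
          (Upstream.ofPrintedAllXPN X Y Z V W).b13) := by
  show ((w.up P).b9 → (w.up P).b10 → (w.up P).b11 → (w.up P).b12 → (w.up P).b13) ↔ _
  rw [hP]
  exact Iff.rfl

include hθ hP in
/-- **N12 at a Stage-1 run**: `Dag.B15_main (leavesP w P)` («b5 → b7 → b8 → b10 → b11 → rBasicStep») ↔ `b7 → b8 → b10 → b11 → B15Leaf W` over the
run's FREE carriers. [cite: Balaban1989LargeFieldI, Prop. 1 p.194 (dictionary, bookkeeping)] -/
theorem b15_main_iff_of_up :
    Dag.B15_main (leavesP w P) ↔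
      ((Upstream.ofPrintedAllXPN X Y Z V W).b7 → (Upstream.ofPrintedAllXPN X Y Z V W).b8 →
        (Upstream.ofPrintedAllXPN X Y Z V W).b10 → (Upstream.ofPrintedAllXPN X Y Z V W).b11 →
          (Upstream.ofPrintedAllXPN X Y Z V W).rBasicStep) := by
  show ((w.up P).b5 → (w.up P).b7 → (w.up P).b8 → (w.up P).b10 → (w.up P).b11 → (w.up P).rBasicStep) ↔ _
  rw [hP]
  exact ⟨fun h => h (carriers₁_b5 θ hθ X Y Z V W), fun h _ => h⟩

end Nodes

/-! ## §4. The ONE-LEVEL side bundle `carriers₁OL θ ν X` -/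

section OneLevel

variable (ν : B6OneLevelParams)

/-- **Leaves over the one-level side bundle** (`rfl`): `b4`, `b5` as over `carriers₁ θ X` (the inner B6 substitution does not touch them), `b6` = the
parameter-form block OF THE ONE-LEVEL KNIT BLOCK `knitBlockG D L a δ₀ (blockGp D L a m²′)`, every other leaf = the leaf over the un-substituted
bundles. [cite: Balaban1984PropagatorsII, (2.1)–(2.2) p.224, Lemma 2.1 – Cor. 2.8 pp.234–249 (dictionary, one-level reading, bookkeeping)] -/
theorem leaves_carriers₁OL :
    (Upstream.ofPrintedAllXPN (carriers₁OL θ ν X) Y Z V W).b4 = (Upstream.ofPrintedAllXPN (carriers₁ θ X) Y Z V W).b4 ∧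
    (Upstream.ofPrintedAllXPN (carriers₁OL θ ν X) Y Z V W).b5 = (Upstream.ofPrintedAllXPN (carriers₁ θ X) Y Z V W).b5 ∧
    (Upstream.ofPrintedAllXPN (carriers₁OL θ ν X) Y Z V W).b6 =
      B6BlockParam (knitBlockG θ.D θ.L θ.a ν.δ₀ (blockGp θ.D θ.L θ.a ν.msq)) ∧
    (Upstream.ofPrintedAllXPN (carriers₁OL θ ν X) Y Z V W).b7 = (Upstream.ofPrintedAllXPN X Y Z V W).b7 ∧
    (Upstream.ofPrintedAllXPN (carriers₁OL θ ν X) Y Z V W).b8 = (Upstream.ofPrintedAllXPN X Y Z V W).b8 ∧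
    (Upstream.ofPrintedAllXPN (carriers₁OL θ ν X) Y Z V W).b9 = (Upstream.ofPrintedAllXPN X Y Z V W).b9 ∧
    (Upstream.ofPrintedAllXPN (carriers₁OL θ ν X) Y Z V W).b10 = (Upstream.ofPrintedAllXPN X Y Z V W).b10 ∧
    (Upstream.ofPrintedAllXPN (carriers₁OL θ ν X) Y Z V W).b11 = (Upstream.ofPrintedAllXPN X Y Z V W).b11 ∧
    (Upstream.ofPrintedAllXPN (carriers₁OL θ ν X) Y Z V W).b12 = (Upstream.ofPrintedAllXPN X Y Z V W).b12 ∧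
    (Upstream.ofPrintedAllXPN (carriers₁OL θ ν X) Y Z V W).b13 = (Upstream.ofPrintedAllXPN X Y Z V W).b13 ∧
    (Upstream.ofPrintedAllXPN (carriers₁OL θ ν X) Y Z V W).rOperation = (Upstream.ofPrintedAllXPN X Y Z V W).rOperation ∧
    (Upstream.ofPrintedAllXPN (carriers₁OL θ ν X) Y Z V W).rBasicStep = (Upstream.ofPrintedAllXPN X Y Z V W).rBasicStep :=
  ⟨rfl, rfl, rfl, rfl, rfl, rfl, rfl, rfl, rfl, rfl, rfl, rfl⟩

variable {θ X Y Z V W ν} (hθ : θ.Admissible) {w : WorldP} {P : B12.RunParams}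
  (hP : w.up P = Upstream.ofPrintedAllXPN (carriers₁OL θ ν X) Y Z V W)

include hθ hP in
/-- **N04 at a run of the one-level reading REDUCES to `B7.Concl` of the run's FREE B7 group** (as at Stage 1: the side bundle pins B6, not B7).
[cite: Balaban1985Averaging, Props. 1–10 pp.26–50 (dictionary, bookkeeping)] -/
theorem b7_main_iff_of_up_OL :
    Dag.B7_main (leavesP w P) ↔ B7.Concl X.L7 X.c₂ X.C₀ X.c₂' X.one7 X.kst7 X.kexp7 X.gd7 X.gone7 := by
  show ((w.up P).b5 → (w.up P).b7) ↔ _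
  rw [hP]
  exact ⟨fun h => h (carriers₁_b5 θ hθ _ Y Z V W), fun h _ => h⟩

include hθ hP in
/-- **N06 at a run of the one-level reading**: with `b4`, `b5`, `b6` discharged (`carriers₁OL_b6`), `Dag.B9_main (leavesP w P) ↔ (b7 → B9LeafX Y)` over the
run's FREE carriers. [cite: Balaban1985BackgroundPropagators, Thms 3.1–3.15 pp.397–432 (dictionary, bookkeeping)] -/
theorem b9_main_iff_of_up_OL :
    Dag.B9_main (leavesP w P) ↔
      ((Upstream.ofPrintedAllXPN X Y Z V W).b7 → (Upstream.ofPrintedAllXPN X Y Z V W).b9) := by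
  show ((w.up P).b4 → (w.up P).b5 → (w.up P).b6 → (w.up P).b7 → (w.up P).b9) ↔ _
  rw [hP]
  exact ⟨fun h => h (carriers₁_b4 θ hθ _ Y Z V W) (carriers₁_b5 θ hθ _ Y Z V W) (carriers₁OL_b6 θ hθ ν X Y Z V W),
    fun h _ _ _ => h⟩

end OneLevel

end Literature.MathematicalPhysics.QuantumFieldTheory.Balaban1983to89.Node00

end
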